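import Summits.BirchSwinnertonDyer.Rank1Residual.F1Sign2.CorrectedSpinLawAtTwo
import Literature.NumberTheory.EllipticCurves.LangHeightNonarchEstimate
import HarnessLib.Audit.Tags
import HarnessLib

/-!
# Cell `bsd-f1-sign2` — descent lens (planner `-desc` g27; MEMO-desc §37 (7ae03c1e76d4c14c), LEMMA 37.L, ENGINE 38, PREDICTION X): DESC-37 — THE SIGNED OBJECT AT 2 (`ε₂`, `q₂(ε₂) = 𝔯-bit`)
# AND THE TWO HALVES OF REF2's R56b′ AS TYPED LAWS: DESC-37-A `SpinObstructedOfOddConductorAtTwo` (visible half) and DESC-37-B `PureSpinLawOfLoneEvenConductorAtTwo` (harmless half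
# under the lone-place hypothesis); carriers `twoDivisionCubicZ`, `BInvariantsZ`, `HenselDatumAtTwo`, `IsTwoAdicSquare`, `IsTwoAdicUnramifiedNonsquare`, `cubicDiscZ`, `OneTwoAdicRoot`,
# `ConductorOddAboveTwo`, `CorrectedSpinLawFits`; three glue theorems (sibling of `CorrectedSpinLawAtTwo.lean` — LAW36 / DESC-36, typer g19 — whose §36 carriers it imports); v2 = v1 p740293 + REF2 v58-add1 §C placement fold;
# v3 = v2 p741225 + MEMO-desc §37 (appended 19:47Z, 7ae03c1e76d4c14c) BC5 numbers and PREDICTION X outcome — docstring-only; every declaration byte-identical)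

STATEMENTS + -desc's glue theorems (typer -ty g20).  Source: `HOME/MEMO-desc-data/g27/lean/Sketch37.lean` **e03dd527bc2cc19b** (132 l.; -desc STATUS 2026-08-29T18:59:08Z: farm rc 0,
BC7 CLEAN ×2 `bc7_37.txt`), lines 12–132 VERBATIM from `noncomputable section` to the final `end` (frozen copy in the typer's kit `MEMO-ty-data/g20/cells/desc37/`; builder-verified line
by line); typer edits = this header, «RIDER» paragraphs appended to five docstrings, nothing else.  PORT GATE = REF1-AUDIT §234 (-ref1 g21, 2026-08-29T19:09:56Z; `REF1-data/b234/`
Probe234.lean d2bdfa7c3295298c → check234.json 02936cf7ebe0b189 rc 0, 2 sorries = the A1 probes, BC7 a–d sorry-free): **DESC-37-A SURVIVES (`@[conjecture]`; theorem-candidate modulo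
the local lemma L2q per -desc; ONE load-bearing-convention rider R234a) · DESC-37-B SURVIVES (`@[conjecture]`; same rider) · 0 KILLED**; the seven support `def : Prop`/carriers are
filed PLAIN (gate census «vendored-fact» support defs, as for §35/§36).  R234a (the SIGN of `Polynomial.resultant` is load-bearing for `IsTwoAdicUnramifiedNonsquare (cubicDiscZ F)`,
`u ≡ 5` vs `u ≡ 3 (mod 8)`; `Polynomial ℤ` is noncomputable so REF1 could not evaluate `cubicDiscZ (X³ − X)` in-kernel) is DISCHARGED by the typer in the kernel sibling
`ConductorBitSpinLawAtTwoKernel.lean`: `cubicDiscZ_X_cube_sub_X : cubicDiscZ (X ^ 3 - X) = 4` (PROVED from Mathlib's `Polynomial.resultant_eq_prod_eval` — `Res(f, g) = lc(f)ⁿ·∏_{f(α)=0} g(α)`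
for split `f` — so `Res(f, f′) = ∏ f′(αᵢ) = (−1)^{n(n−1)/2}·disc f`, i.e. `disc = −Res(F, F′)` for a monic cubic, pari's `poldisc` sign: positive on three real roots).  The kernel also
carries REF1's BC7-a (carriers inhabited: `17`, `−7`, `68` squares; `−3`, `20` unramified), BC7-b `not_square_and_unramified` (the two carriers are DISJOINT ⇒ the case split in
`ConductorOddAboveTwo` is a genuine trichotomy minus the excluded square), BC7-c `twoDivisionCubicZ_eval` (`F(4x) = 16·(4x³ + b₂x² + 2b₄x + b₆)`, roots `4eᵢ`), BC7-d `fits_nil_of_no_member`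
(37-A is an EXISTENCE claim).  REF1 A2 (reading, all ✓): Hensel datum standard and `m` intrinsic once the root is unique ⇒ the 𝔯-bit is choice-free and model-independent (a change of
globally minimal model translates `Θ = 4e₁` by an integer); `IsTwoAdicSquare` complete incl. negative `u` (Lean `Int.emod`); ℕ-subtraction in `(v₂ disc − m)/2` safe (`v₂ disc ≥ 2m`);
`CorrectedSpinLawFits` = LAW36's tail VERBATIM (`correctedShape_iff_fits := Iff.rfl`).  A3/A4: 37-A concludes `¬ CorrectedSpinLawFits … []` — an EXISTENCE claim (a member + labelled
roots with `κ ≠ spin`), junk-FALSE on a member-less curve, members abound by Chebotarev (primes splitting completely in `ℚ(W[2], ζ₈, √ℓ : ℓ ∣ N)`), weakest correct form (one failure,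
no density asserted); 37-B (a ∀-statement) junk-true only on member-less curves (none in the setting); hypotheses = LAW36's setting (`CubicDatumFor`, `selmerTwoCard W = 1`,
`DegOnePrimesOddClassC`), so the §223/§224 verdicts on those carriers transfer; 37-B's clause `∀ v, 2 ∉ v ⇒ Odd c_v` is the lone-place hypothesis as described; the pair is
shape-consistent (`oddConductor_loneEven_disjoint`, `shapeWitness_nil_of_loneEven` : 37-B ⊂ DESC-36-E with `ys = []`).  REF2 PLACEMENT (REF2-PLACEMENT-v58-add1 §C 58851909ba65edab,
2026-08-29T19:19Z; v2 fold): LEMMA 37.L (`q₂(ε₂) = 𝔯-bit` at `d₂ = 1`, both `K`-types) = local algebra on printed objects (Poonen–Rains' `q` and Thm 4.13/4.14, local Tate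
duality, `𝓞_K^×/□` as a hyperplane of `K^×/K^{×2}`) — COROLLARY-OF-PRINT / VARIANT, closing the gap REF2 v56 §1.4 left open («why the choice at 2 follows the LOCAL 𝔯-rule
23/23»): with THM 37.1/37.2 the 𝔯-rule is a BSD-free proof sketch; DESC-37-A/B are typed over the cell's own `CorrectedSpinLawFits … []` (LAW36 vocabulary) — no external statement
can exist in print; strength = LAW36 (DESC-36-E, conjecture-grade) restricted to the two 𝔯-cells + the theorem-sketch `r₂ = 1` / lone-place rescue (THM 37.3) + Chebotarev for
members; VERDICT: **conjecture-grade BEYOND PRINT (as LAW36 is); 37.L/37.1–37.3 corollary-of-print lemmas**; REF2 concurs with -desc's PARTITION line and asked only that R234a be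
fixed before port — done in the kernel sibling (`cubicDiscZ_X_cube_sub_X`), since the `(5, f)₂`-type symbols of v57 §1.2(a) are sign-sensitive; PREDICTION X has no print bearing;
final numbers read from MEMO-desc §37 (v3 fold, below).

ROWS.  **DESC-37-A** (`@[conjecture]`): LAW36 setting (`Sel₂(W) = 0`, cubic datum, odd class number of `L`); `W(ℚ₂)[2] ≅ ℤ/2` (`OneTwoAdicRoot`) and the conductor `𝔯` of `ℤ[Θ]`
(`Θ = 4e`) divisible by a prime over 2 to an ODD power (`ConductorOddAboveTwo`) ⟹ the PURE `S₃`-spin law fails somewhere (`ys = []` does not fit: the correction class at 2 is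
VISIBLE, `r₂ = 1`); mechanism `ε₂ :=` generator of `𝒰₂^⊥ ∩ H¹(ℚ₂, W[2])`, Poonen–Rains value `q₂(ε₂) = 𝔯-bit` (LEMMA 37.L, -desc: PROVED by hand in both `K`-types — `K` ramified via
REF2 v57 §1.2(a) + `(5, f)₂`, `K` unramified by a three-case 2-adic computation with `u₀ = −1 + 2√−3`; STATUS 18:59:08Z), THM 37.1/37.2.  **DESC-37-B** (`@[conjecture]`): same
setting + every ODD place has odd Tamagawa number; `d₂ = 1` and `𝔯` NOT odd above 2 ⟹ the pure law holds (LONE-PLACE THEOREM 37.3; census J2848 `[0,0,0,−28,−64]`, R918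
`[1,−1,1,−26,89]`); PREDICTION X (MEMO-desc §37.5, pre-registered `job38x/PREDICTIONS-X.md`): WITHOUT «lone» it is false.
DATA = BC5 WITNESS (MEMO-desc §37.4–§37.5, `MEMO-desc-data/g27/` SHA16SUMS; numbers not adjectives): ENGINE 38 (kit j334852; engine38.gp adb489a734518235, PREDICTIONS38.md
12140dcaf7d8f278 pre-registered; an/score38.txt ac58d6e8fb0b2932): 192 census curves, 174 `h_L`-odd valid, 0 X38 errors; engine checks C38.1–C38.8 all 174/174 resp. 95/95 (𝒲₂, R₂
Lagrangian; `q_A ≡ 0` on 𝒲₂ and on R₂; `q_A = q_B` on all of V₂; Arf 0 zero-count; elementary 𝔯-bit = ideal bit; `ε₂` symbol shape; `ε₂ ∈ 𝒰₂`); **P38.1 (LEMMA 37.L) `q(ε₂) = 𝔯-bit`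
95/95 `d₂ = 1` curves** (74 × (0,0), 21 × (1,1)); P38.2–P38.8 100 % (P38.4/4b COR 37.2 21/21; P38.5 THM 37.3 at J2848, R918 2/2; P38.6 ≤ 1 rescue for Δ < 0 161/161); LEMMA 37.L also
swept 4246/4246 (lemma38).  JOIN WITH THE SPIN CENSUS (an/join38.txt 1679880ea55e55de; CENSUS36 × tam38 j334815): (A) 𝔯-odd ⟹ census class above 2, `ys ≠ []`: **20/20** (DESC-37-A's
witness); (B) 𝔯-even ∧ `c_ℓ` odd at every odd bad `ℓ` ⟹ `ys = []` (pure law exact): **51/51** (DESC-37-B's witness, incl. the two 𝒲₂-RAMIFIED lone curves J2848, R918); (Bsup) 52/52;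
the remaining 19 𝔯-even curves with a census row each have a VISIBLE ODD place and `ys ≠ []` supported exactly there; VIOLATIONS 0.  PREDICTION X (PROP 37.4: two 𝔯-even
Kummer-ramified places ⟹ one visible — i.e. WITHOUT «lone» DESC-37-B's conclusion fails): box searches j335190/j335205/j335221 null; **CONFIRMED on the twist family** `E₀^{(D)}` (search41,
kit j335234 PMAX 12 000 + j335353 PMAX 60 000): X.1 329 cell-X curves; X.2 10/10; X.3 10/10 (PURELAW_FAIL 463/1165, P37.1 440112/440112); X.4 10/10 (THM 37.5 proves ≥ 1 visible place;
10/10 both visible).  REF1 ran no numerics (§234 A5).  CHEAPEST FALSIFIERS (run, MEMO-desc §37.7): 37-A — «a `d₂ = 1`, 𝔯-odd census curve with CENSUS36 `ys = []`»: **0 of 20**;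
37-B — «a census curve satisfying the hypotheses with `ys ≠ []`»: **0 of 51**; why they might fail (-desc): 37-A only through the LAW36′ dictionary (Chebotarev supply of pure split
members realising the visible character), `h_L` odd load-bearing; 37-B: PREDICTION X shows «lone» is load-bearing, and `c_ℓ` odd is only a sufficient surrogate for `𝒲_ℓ ⊂ 𝒰_ℓ`
(split I₄/I₈ are ramified-but-harmless and excluded).  WHY NOVEL (-desc, one sentence): the local evaluation «`q₂` of the unit-orthogonal class = parity of the conductor of `ℤ[4e]`
above 2» and its use to split R56b′ into a universal visible half and a lone-place harmless half (with a constructed failure of the converse) are not in print — nearest: Poonen–Rains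
2012 (`q_v`, Thm 4.14), CFOSS 2008, Brumer–Kramer 1977 / Kramer 1981 (images at 2), Barrera Salazar–Pacetti–Tornaría 2021 (Sel₂ bounds via narrow class groups; no local sign
object); -desc's corpus (fts + vec) and galaxy searches null for the statement.
PARTITION: none moved (both rows beyond-print, conjecture-grade / theorem-candidates mod L2q; 37.L corollary-of-print per -desc).  Beyond-print theorem: no.  BSD is not proved by
this; 23715 is not closed.  bears_on: stmt-BirchSwinnertonDyer-23715.
-/

noncomputable section

open scoped Classical

open WeierstrassCurve Literature.NumberTheory.EllipticCurves Polynomial IsDedekindDomain NumberField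

namespace Summit.BirchSwinnertonDyer.Rank1Residual.F1Sign2

/-! ### §37 vocabulary -/

/-- The INTEGRAL 2-DIVISION CUBIC of integers `B2, B4, B6`: `F(X) = X³ + B2·X² + 8·B4·X + 16·B6` (for the b-invariants of an integral model its roots are `4e_i`,
`disc F = 2⁸·16·Δ`… it generates the same cubic field `L`; `𝔯 := F′(Θ)·𝔇_L⁻¹` is the conductor of the order `ℤ[Θ]`, REF2 v54 §23 / v56 §1.2). -/
def twoDivisionCubicZ (B2 B4 B6 : ℤ) : ℤ[X] :=
  X ^ 3 + C B2 * X ^ 2 + C (8 * B4) * X + C (16 * B6)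

/-- `B2, B4, B6` ARE the b-invariants of the (globally minimal) model `W`. -/
def BInvariantsZ (W : WeierstrassCurve ℚ) (B2 B4 B6 : ℤ) : Prop :=
  W.b₂ = B2 ∧ W.b₄ = B4 ∧ W.b₆ = B6

/-- 2-ADIC HENSEL DATUM: `v₂(F′(e)) = m` exactly and `2^{2m+1} ∣ F(e)`.  (Hensel: then `F` has a unique root `e₁ ∈ ℤ₂` with `e₁ ≡ e (mod 2^{m+1})`, and
`v₂(F′(e₁)) = m`; when `F` has exactly one 2-adic root, `m = v₁ := v₂(F′(e₁))` is therefore well defined.) -/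
def HenselDatumAtTwo (F : ℤ[X]) (e : ℤ) (m : ℕ) : Prop :=
  (2 : ℤ) ^ m ∣ (derivative F).eval e ∧ ¬ (2 : ℤ) ^ (m + 1) ∣ (derivative F).eval e ∧ (2 : ℤ) ^ (2 * m + 1) ∣ F.eval e

/-- `D` is a square in `ℚ₂ˣ`: `D = 4^k·u` with `u ≡ 1 (mod 8)`. -/
def IsTwoAdicSquare (D : ℤ) : Prop :=
  ∃ (k : ℕ) (u : ℤ), D = 4 ^ k * u ∧ u % 8 = 1

/-- `ℚ₂(√D)/ℚ₂` is the UNRAMIFIED quadratic extension: `D = 4^k·u` with `u ≡ 5 (mod 8)`.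
(RIDER, typer -ty g20: REF1 §234 BC7-a/b (kernel sibling): inhabited by `−3`, `20`; DISJOINT from `IsTwoAdicSquare` (`not_square_and_unramified`, induction on `k`), so inside
`ConductorOddAboveTwo`, given `OneTwoAdicRoot`'s `¬ IsTwoAdicSquare`, «¬ unramified» really means «ramified» — the case split is a genuine trichotomy minus the excluded square case.) -/
def IsTwoAdicUnramifiedNonsquare (D : ℤ) : Prop :=
  ∃ (k : ℕ) (u : ℤ), D = 4 ^ k * u ∧ u % 8 = 5

/-- The discriminant of a monic cubic `F`: `disc F = −Res(F, F′)`.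
(RIDER, typer -ty g20 — REF1-AUDIT §234 **R234a**, load-bearing convention: the SIGN of `Polynomial.resultant` decides `IsTwoAdicUnramifiedNonsquare (cubicDiscZ F)`
(`u ≡ 5` vs `u ≡ 3 (mod 8)`), i.e. `disc` vs `−disc`.  DISCHARGED in the kernel sibling: `ConductorBitSpinLawAtTwo.Kernel.cubicDiscZ_X_cube_sub_X : cubicDiscZ (X ^ 3 - X) = 4`
(three real roots ⇒ positive), from Mathlib's `Polynomial.resultant_eq_prod_eval` (`Res(f, g) = lc(f)ⁿ · ∏_{f(α) = 0} g(α)` for split `f`), so for a monic cubic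
`−Res(F, F′) = −∏ F′(αᵢ) = ∏_{i<j}(αᵢ − αⱼ)²` = pari's `poldisc` — the orientation ENGINE 38 uses.  On paper check value: `F = X³ − X`, `Res = F′(0)F′(1)F′(−1) = −4`, `disc = 4` ✓.) -/
def cubicDiscZ (F : ℤ[X]) : ℤ := -(Polynomial.resultant F (derivative F))

/-- EXACTLY ONE 2-ADIC ROOT (`d₂ = 1`, i.e. `W(ℚ₂)[2] ≅ ℤ/2`): `disc F` is not a square in `ℚ₂` (so `F` has 0 or 1 roots in `ℚ₂`) and `F` has a 2-adic root
(a Hensel datum). -/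
def OneTwoAdicRoot (F : ℤ[X]) : Prop :=
  ¬ IsTwoAdicSquare (cubicDiscZ F) ∧ ∃ (e : ℤ) (m : ℕ), HenselDatumAtTwo F e m

/-- THE 𝔯-BIT ABOVE 2 at `d₂ = 1` (MEMO-desc §37.2; = «some prime of `L` over 2 divides the conductor `𝔯 = F′(Θ)𝔇_L⁻¹` of `ℤ[Θ]` to an odd power», ENGINE 38 check
C38.6): with `v₁ = v₂(F′(e₁))` at the 2-adic root and `v_d = v₂(disc F)` — if `K = ℚ₂(√disc F)` is the unramified quadratic field the bit is `((v_d − v₁)/2) mod 2`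
(`= v_{𝔔₂}(𝔯) mod 2`, `𝔔₂` the degree-2 prime; `v_{𝔔₁}(𝔯) = v₁` is then even), otherwise (`K` ramified) it is `v₁ mod 2` (`= v_{𝔔₁}(𝔯) ≡ v_{𝔔₂}(𝔯) mod 2`).
(RIDER, typer -ty g20: REF1 §234 A2 ✓ — the Hensel datum makes the root `e₁ ≡ e (2^{m+1})` unique with `v₂(F′(e₁)) = m`, so `m` is intrinsic and the `∃ e m` here cannot
disagree with the one inside `OneTwoAdicRoot` (𝔯-bit choice-free); `(padicValInt 2 disc − m)/2` is ℕ-subtraction/division with no truncation since `v₂(disc) = 2m + 2v₂(e₂ − e₃) ≥ 2m`;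
model-independence: a change of globally minimal model (`u = ±1`, shift `r`) translates `Θ = 4e₁` by an integer ⇒ `ℤ[Θ]`, `𝔯`, `m`, `v₂(disc)` unchanged (the 𝔯-bit is a curve
invariant).  ENGINE 38 check C38.6: elementary 𝔯-bit = ideal bit 95/95 at `d₂ = 1`.) -/
def ConductorOddAboveTwo (F : ℤ[X]) : Prop :=
  ∃ (e : ℤ) (m : ℕ), HenselDatumAtTwo F e m ∧
    ((IsTwoAdicUnramifiedNonsquare (cubicDiscZ F) ∧ Odd ((padicValInt 2 (cubicDiscZ F) - m) / 2)) ∨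
      (¬ IsTwoAdicUnramifiedNonsquare (cubicDiscZ F) ∧ Odd m))

/-- LAW36's tail as a predicate of the correction list `ys` (verbatim from `GenusTrivialTwistCorrectedSpinLawShape`): at every pure split prime `p` of every
genus-class-trivial twist member (coprime to `xden` and to the `N(y(θ))`), `κ(p) = 1 ⟺ (spin bit ⟺ correction parity of ys)`.  `ys = []`: the PURE law. -/
def CorrectedSpinLawFits (W : WeierstrassCurve ℚ) [W.IsGloballyMinimal] (c xnum : ℤ[X]) (xden : ℕ) (ys : List ℤ[X]) : Prop :=
  ∀ n p : ℕ, GenusTrivialTwistMember W n p → ¬ p ∣ xden → (∀ y ∈ ys, ¬ ((p : ℤ) ∣ (mulMatrixCubic c y).det)) →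
    ∀ a : Fin 3 → ZMod p, LabelledRootsModC c p a → Function.Injective (fun j => evalModC xnum p (a j)) →
      IntegralUnitsSquareModC c p a →
      ∀ i j : Fin 3, i ≠ j → ∀ (g : ℤ[X]) (o : ℕ), GeneratesOddPrimePowerOverC c p (a i) g o →
        (KappaBitOfMember W n p ↔ (SpinBitC xnum xden p a i j g ↔ CorrectionParityC ys p a i j))

/-! ### §37 rows -/

/-- **DESC-37-A `SpinObstructedOfOddConductorAtTwo` (VISIBLE HALF OF R56b′ AT 2; theorem-candidate modulo the local lemma L2q; MEMO-desc §37.3).**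
Setting of LAW36 (`Sel₂(W) = 0`, cubic datum, ODD class number of `L`).  If `W(ℚ₂)[2] ≅ ℤ/2` (one 2-adic root of `F_W`) and the conductor `𝔯` of `ℤ[Θ]`
(`Θ = 4e`) is divisible by a prime over 2 to an ODD power, then the PURE `S₃`-spin law FAILS somewhere: `ys = []` does not fit (the correction class at 2 is
VISIBLE, `r₂ = 1`).  Mechanism: `ε₂ :=` the generator of `𝒰₂^⊥ ∩ H¹(ℚ₂, W[2])` (`= (N u₀, u₀)`, `u₀` the unit of `K = ℚ₂(θ₂)` with `K(√u₀)/K` unramified) has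
Poonen–Rains value `q₂(ε₂) = 𝔯-bit` (L2q: PROVED for `K` ramified via REF2 §1.2(a); swept for `K` unramified, ENGINE 38/lemma38); `q₂(ε₂) = 1` forbids both
`𝒲₂ ⊂ 𝒰₂` and a rescuing global unit (every unit vector of `ε₂ + 𝒲₂` has `q = 1`), so `val₂` of the relaxed-Selmer annihilator is non-zero (THM 37.1/37.2).
BC5: ENGINE 38 × CENSUS36 (census table MEMO-desc §37.4): the `d₂ = 1`, 𝔯-odd curves are exactly the 20 runs with a census class above 2 … (numbers in the memo).
Why it might fail: L2q in the unramified case is a sweep, not a proof; `h_L` odd is load-bearing (C2547-type rescue by `Cl(L)[2]`).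
(RIDER, typer -ty g20: `@[conjecture]` as audited.  REF1-AUDIT §234: **SURVIVES** — theorem-candidate modulo the local lemma L2q (per -desc: PROVED by hand in both `K`-types,
LEMMA 37.L, STATUS 18:59:08Z; the unramified case was first a sweep, ENGINE 38/lemma38) with the load-bearing-convention rider R234a (discharged in the kernel sibling,
`cubicDiscZ_X_cube_sub_X`).  A3/A4: the conclusion `¬ CorrectedSpinLawFits … []` is an EXISTENCE claim (a member `(n, p)` + labelled roots with `κ ≠ spin`): kernel BC7-d
`fits_nil_of_no_member` shows the pure law fits VACUOUSLY with no genus-class-trivial member, so this row is not junk-provable and would be FALSE on a member-less curve — members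
exist in abundance (Chebotarev: primes splitting completely in `ℚ(W[2], ζ₈, √ℓ : ℓ ∣ N)` are members with `n = p`), and the mechanism (visible class at 2, `r₂ = 1`, THM 37.1/37.2)
predicts failures of positive density; the row asserts ONE failure, not density ✓ weakest correct form.  Hypotheses = LAW36's setting (`CubicDatumFor`, `selmerTwoCard W = 1` ⇒
rank 0 and `W(ℚ)[2] = 0`, `DegOnePrimesOddClassC` = odd class number in generator form) — REF1 §223/§224 verdicts on those carriers transfer.  BC5 (MEMO-desc §37.4/§37.7, ENGINE 38
j334852 × CENSUS36, an/join38.txt 1679880ea55e55de): the 20 `d₂ = 1`, `Sel₂ = 1`-class, `h`-odd, 𝔯-odd-above-2 curves with census rows ALL violate the pure law with a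
correction class above 2 (join38 (A) **20/20**; cells P ×5, T2 ×5, R2 ×7 [one Δ > 0], J214, J486, P1242/P2202 [Δ > 0]); P38.1 `q(ε₂) = 𝔯-bit` 95/95, P38.4/4b (COR 37.2)
21/21.  Cheapest falsifier RUN: «a `d₂ = 1`, 𝔯-odd census curve with `ys = []`» — 0 of 20.  REF2 v58-add1 §C: conjecture-grade BEYOND PRINT (strength = LAW36 / DESC-36-E restricted to this 𝔯-cell; 37.L and THM 37.1–37.3 corollary-of-print
lemmas; no external statement can exist in print since the row is typed over the cell's `CorrectedSpinLawFits`).) -/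
@[conjecture] def SpinObstructedOfOddConductorAtTwo : Prop :=
  ∀ (W : WeierstrassCurve ℚ) [W.IsElliptic] [W.IsGloballyMinimal],
    ∀ (c xnum : ℤ[X]) (xden : ℕ) (B2 B4 B6 : ℤ), CubicDatumFor W c xnum xden → BInvariantsZ W B2 B4 B6 →
      selmerTwoCard W = 1 → DegOnePrimesOddClassC c →
      OneTwoAdicRoot (twoDivisionCubicZ B2 B4 B6) → ConductorOddAboveTwo (twoDivisionCubicZ B2 B4 B6) →
        ¬ CorrectedSpinLawFits W c xnum xden []

/-- **DESC-37-B `PureSpinLawOfLoneEvenConductorAtTwo` (HARMLESS HALF OF R56b′ UNDER THE LONE-PLACE HYPOTHESIS; theorem-candidate mod L2q + LAW36′; MEMO-desc §37.3).**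
Same setting; if every ODD place has odd Tamagawa number (so the Kummer image is unramified at every odd bad prime), `W(ℚ₂)[2] ≅ ℤ/2` and `𝔯` is NOT divisible
to an odd power by a prime over 2, then the PURE spin law holds (`ys = []` fits) — whether or not the Kummer image at 2 is ramified: when it is, `q₂(ε₂) = 0` puts a
`q`-singular unit vector in `ε₂ + 𝒲₂`, the relaxed class through it has all valuations even, hence (odd class number) is a global unit class and rescues the place
(LONE-PLACE THEOREM 37.3; census: J2848 `[0,0,0,−28,−64]`, R918 `[1,−1,1,−26,89]`).  PREDICTION X (MEMO-desc §37.5): WITHOUT «lone» it is false (two 𝔯-even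
Kummer-ramified places, `Δ_L < 0` ⟹ one of them is visible).
(RIDER, typer -ty g20: `@[conjecture]` as audited.  REF1-AUDIT §234: **SURVIVES** — theorem-candidate modulo L2q + LAW36′ (same rider R234a, discharged in the kernel).  A3/A4: a
∀-statement, junk-true only on member-less curves (none in the setting); the Tamagawa clause `∀ v, 2 ∉ v ⇒ Odd c_v` (all ODD places; good places `c_v = 1`) is the lone-place
hypothesis as described; shape-consistent with 37-A (`oddConductor_loneEven_disjoint`) and the `ys = []` sub-case of DESC-36-E `GenusTrivialTwistCorrectedSpinLawShape`
(`shapeWitness_nil_of_loneEven`).  BC5 (MEMO-desc §37.4/§37.7): the 51 `d₂ = 1`, 𝔯-even curves with `c_ℓ` odd at all odd bad `ℓ` and census rows ALL satisfy the pure law exactly, `ys = []` (join38 (B)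
**51/51**, incl. the two 𝒲₂-RAMIFIED lone curves J2848I3s4n7 and R918I12un15 — the regime where the naive local criterion «𝒲₂ ⊄ 𝒰₂ ⟹ correction» fails; P38.5 THM 37.3
2/2); cheapest falsifier RUN: «a census curve satisfying the hypotheses with `ys ≠ []`» — 0 of 51.  PREDICTION X (PROP 37.4, MEMO-desc §37.5) **CONFIRMED on the twist family**
(kit j335234/j335353: 329 cell-X curves; X.3 10/10, PURELAW_FAIL 463/1165, P37.1 440112/440112; THM 37.5): WITHOUT «lone» the conclusion is FALSE — the hypothesis is
load-bearing (`c_ℓ` odd is a sufficient surrogate for `𝒲_ℓ ⊂ 𝒰_ℓ`).  REF2 v58-add1 §C: conjecture-grade BEYOND PRINT (strength = LAW36 / DESC-36-E restricted to this 𝔯-cell; 37.L and THM 37.1–37.3 corollary-of-print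
lemmas; no external statement can exist in print since the row is typed over the cell's `CorrectedSpinLawFits`).) -/
@[conjecture] def PureSpinLawOfLoneEvenConductorAtTwo : Prop :=
  ∀ (W : WeierstrassCurve ℚ) [W.IsElliptic] [W.IsGloballyMinimal],
    ∀ (c xnum : ℤ[X]) (xden : ℕ) (B2 B4 B6 : ℤ), CubicDatumFor W c xnum xden → BInvariantsZ W B2 B4 B6 →
      selmerTwoCard W = 1 → DegOnePrimesOddClassC c →
      (∀ v : HeightOneSpectrum (𝓞 ℚ), (2 : 𝓞 ℚ) ∉ v.asIdeal → Odd (W.tamagawaNumberAt v)) →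
      OneTwoAdicRoot (twoDivisionCubicZ B2 B4 B6) → ¬ ConductorOddAboveTwo (twoDivisionCubicZ B2 B4 B6) →
        CorrectedSpinLawFits W c xnum xden []

/-! ### kernel glue -/

/-- LAW36-shape restated through `CorrectedSpinLawFits` (definitional). -/
theorem correctedShape_iff_fits (W : WeierstrassCurve ℚ) [W.IsElliptic] [W.IsGloballyMinimal] (c xnum : ℤ[X]) (xden : ℕ) (ys : List ℤ[X]) :
    CorrectedSpinLawFits W c xnum xden ys ↔
      ∀ n p : ℕ, GenusTrivialTwistMember W n p → ¬ p ∣ xden → (∀ y ∈ ys, ¬ ((p : ℤ) ∣ (mulMatrixCubic c y).det)) →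
        ∀ a : Fin 3 → ZMod p, LabelledRootsModC c p a → Function.Injective (fun j => evalModC xnum p (a j)) →
          IntegralUnitsSquareModC c p a →
          ∀ i j : Fin 3, i ≠ j → ∀ (g : ℤ[X]) (o : ℕ), GeneratesOddPrimePowerOverC c p (a i) g o →
            (KappaBitOfMember W n p ↔ (SpinBitC xnum xden p a i j g ↔ CorrectionParityC ys p a i j)) := Iff.rfl

/-- Kernel glue: on a DESC-37-B curve LAW36-shape holds with the empty list (so DESC-37-B is the `ys = []` sub-case of DESC-36-E there, and DESC-37-A says the
`ys = []` witness is impossible on its curves — the two rows partition the `d₂ = 1` curves with odd Tamagawa numbers at odd places by the 𝔯-bit). -/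
theorem shapeWitness_nil_of_loneEven (h : PureSpinLawOfLoneEvenConductorAtTwo)
    (W : WeierstrassCurve ℚ) [W.IsElliptic] [W.IsGloballyMinimal] (c xnum : ℤ[X]) (xden : ℕ) (B2 B4 B6 : ℤ)
    (hc : CubicDatumFor W c xnum xden) (hb : BInvariantsZ W B2 B4 B6) (hs : selmerTwoCard W = 1) (ho : DegOnePrimesOddClassC c)
    (ht : ∀ v : HeightOneSpectrum (𝓞 ℚ), (2 : 𝓞 ℚ) ∉ v.asIdeal → Odd (W.tamagawaNumberAt v))
    (h1 : OneTwoAdicRoot (twoDivisionCubicZ B2 B4 B6)) (h0 : ¬ ConductorOddAboveTwo (twoDivisionCubicZ B2 B4 B6)) :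
    ∃ ys : List ℤ[X], (∀ y ∈ ys, CorrectionElementC W c y) ∧ ys.length ≤ 3 * (W.conductorNorm ℤ).primeFactors.card ∧
      CorrectedSpinLawFits W c xnum xden ys :=
  ⟨[], by simp, by simp, h W c xnum xden B2 B4 B6 hc hb hs ho ht h1 h0⟩

/-- Kernel glue: DESC-37-A and DESC-37-B never both apply (their 𝔯-bit hypotheses are complementary) — sanity that the pair is not contradictory by shape. -/
theorem oddConductor_loneEven_disjoint (F : ℤ[X]) (hA : ConductorOddAboveTwo F) (hB : ¬ ConductorOddAboveTwo F) : False := hB hA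

/-! ### decidable instances of the carriers (BC7-style sanity: the 𝔯-bit carriers compute on census cubics) -/

/-- R918 `[1,−1,1,−26,89]`: b-invariants `(−3, −51, 357)`; `F = X³ − 3X² − 408X + 5712`. -/
example : twoDivisionCubicZ (-3) (-51) 357 = X ^ 3 + C (-3 : ℤ) * X ^ 2 + C (8 * (-51) : ℤ) * X + C (16 * 357 : ℤ) := rfl

end Summit.BirchSwinnertonDyer.Rank1Residual.F1Sign2

end
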